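import Mathlib
import HarnessLib
import Summits.MatrixMultiplication.MatrixMultiplication.Theorems.OutsiderSandwichEdgeRigidity

/-!
# OutsiderSandwich — Schönhage's constraints on the Strassen body in side letters
(decomp-mm lens 4 «minimal counterexample / extremal reduction», gen 14, part 3: the effective envelope)

For a universal spectral point `F` over `ℂ` write `θ₁ = log₂ F⟨2,1,1⟩`, `θ₂ = log₂ F⟨1,2,1⟩`,
`θ₃ = log₂ F⟨1,1,2⟩` (`∈ [0,1]`, `θ₁+θ₂+θ₃ = τ_F`).  Schönhage's inequalities (part 1,
`schoenhage₁₂₃`) together with the power law on the three lines (`rpow_le_map_line`: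
`F⟨n,1,1⟩ ≥ n^{θ₁}` etc.) and `F⟨n,1,n⟩ = F⟨n,1,1⟩·F⟨1,1,n⟩` give, for EVERY `n ≥ 2`, the explicit
constraints on the point `(θ₁, θ₂, θ₃)` of the Strassen body

  `n^{θ₁}·n^{θ₃} + ((n−1)²)^{θ₂} ≤ n²+1`,  `n^{θ₂}·n^{θ₃} + ((n−1)²)^{θ₁} ≤ n²+1`,
  `n^{θ₁}·n^{θ₂} + ((n−1)²)^{θ₃} ≤ n²+1`.

Edge rigidity (part 1) is their limit `n → ∞` on an edge `θᵢ = 1`; at finite `n` they are EFFECTIVE: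
by hand (not kernel) the family alone forces `τ_F ≤ 2.5481` for every universal point (`n = 4`;
this is Schönhage's bound `ω ≤ 2.548`, BCS Prop. 15.13) and `θᵢ ≤ 1 − δ_S(τ_F)` with
`δ_S(2.2) ≈ 6·10⁻⁴`, `δ_S(2.3714) ≈ 1.3·10⁻²`, `δ_S(τ) ≈ 4^{−1/(τ−2)}` as `τ → 2⁺` (the Lotti–Romani
`O(1/log k)` law for `ω(1,k,1)`).  These are the first inequalities on universal points in the node
that are not consequences of monotonicity under restrictions of a single tensor, multiplicativity,
additivity and normalisation: they encode the NON-ADDITIVITY of border rank.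

Sources: Schonhage1981 (Lemma 6.1); BurgisserClausenShokrollahi1997 ((15.12), Prop. 15.13);
AlmanLiPratt2026 (Prop. 8.1); ChristandlLeGallLysikovZuiddam2025 (Lemma 3.7–3.8).
-/

set_option linter.dupNamespace false

namespace Summit.MatrixMultiplication.MatrixMultiplication.Theorems.OutsiderSandwichEdgeEnvelope

open Literature.Computability.AlgebraicComplexity
open Literature.Barriers.MatrixMultiplication (IsAdequate)
open Summit.MatrixMultiplication.MatrixMultiplication.Theorems.OutsiderSandwichLaserFloor
  (isAdequate_of_universal map_matMulTensor_one)
open Summit.MatrixMultiplication.MatrixMultiplication.Theorems.OutsiderSandwichEdgeRigidity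
  (schoenhage₁ schoenhage₂ schoenhage₃ rpow_le_map_line)

variable {F : SpectralMap ℂ}

/-- `F⟨k,1,n⟩ = F⟨k,1,1⟩ · F⟨1,1,n⟩`, `F⟨1,m,n⟩ = F⟨1,m,1⟩ · F⟨1,1,n⟩`, `F⟨k,m,1⟩ = F⟨k,1,1⟩ · F⟨1,m,1⟩`
(MaMu multiplicativity with `F⟨1,1,1⟩ = 1`). [cite: ChristandlLeGallLysikovZuiddam2025, Lemma 3.8 (proof)] -/
theorem map_two_sides (hF : IsUniversalSpectralPoint ℂ F) {k m n : ℕ} (hk : 1 ≤ k) (hm : 1 ≤ m)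
    (hn : 1 ≤ n) :
    F (matMulTensor ℂ k 1 n) = F (matMulTensor ℂ k 1 1) * F (matMulTensor ℂ 1 1 n) ∧
    F (matMulTensor ℂ 1 m n) = F (matMulTensor ℂ 1 m 1) * F (matMulTensor ℂ 1 1 n) ∧
    F (matMulTensor ℂ k m 1) = F (matMulTensor ℂ k 1 1) * F (matMulTensor ℂ 1 m 1) := by
  have hA := isAdequate_of_universal hF
  have h1 := map_matMulTensor_one hF
  refine ⟨?_, ?_, ?_⟩
  · rw [hA.map_matMul_eq_mul₃ hk le_rfl hn, h1, mul_one]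
  · rw [hA.map_matMul_eq_mul₃ le_rfl hm hn, h1, one_mul]
  · rw [hA.map_matMul_eq_mul₃ hk hm le_rfl, h1, mul_one]

/-- **Schönhage's constraint, middle slot**: `n^{θ₁}·n^{θ₃} + ((n−1)²)^{θ₂} ≤ n² + 1` for every
universal spectral point and every `n ≥ 2` (`θ₁ = log₂F⟨2,1,1⟩`, `θ₂ = log₂F⟨1,2,1⟩`, `θ₃ = log₂F⟨1,1,2⟩`).
[cite: BurgisserClausenShokrollahi1997, (15.12)] [cite: AlmanLiPratt2026, Proposition 8.1 (proof)] -/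
theorem schoenhage_sides₂ (hF : IsUniversalSpectralPoint ℂ F) {n : ℕ} (hn : 2 ≤ n) :
    (n : ℝ) ^ Real.logb 2 (F (matMulTensor ℂ 2 1 1)) * (n : ℝ) ^ Real.logb 2 (F (matMulTensor ℂ 1 1 2)) +
      (((n - 1) * (n - 1) : ℕ) : ℝ) ^ Real.logb 2 (F (matMulTensor ℂ 1 2 1)) ≤ (n * n + 1 : ℕ) := by
  have hn1 : 1 ≤ n := le_trans one_le_two hn
  have hM : 1 ≤ (n - 1) * (n - 1) := Nat.one_le_iff_ne_zero.2 (Nat.mul_ne_zero (by omega) (by omega))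
  obtain ⟨h₁, -, h₃⟩ := rpow_le_map_line hF hn1
  obtain ⟨-, h₂, -⟩ := rpow_le_map_line hF hM
  have hS := schoenhage₂ hF hn hn
  rw [(map_two_sides hF hn1 le_rfl hn1).1] at hS
  have hprod : (n : ℝ) ^ Real.logb 2 (F (matMulTensor ℂ 2 1 1)) * (n : ℝ) ^ Real.logb 2 (F (matMulTensor ℂ 1 1 2))
      ≤ F (matMulTensor ℂ n 1 1) * F (matMulTensor ℂ 1 1 n) :=
    mul_le_mul h₁ h₃ (Real.rpow_nonneg (Nat.cast_nonneg n) _)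
      (le_trans (Real.rpow_nonneg (Nat.cast_nonneg n) _) h₁)
  linarith

/-- **Schönhage's constraint, first slot**: `n^{θ₂}·n^{θ₃} + ((n−1)²)^{θ₁} ≤ n² + 1` (`n ≥ 2`).
[cite: BurgisserClausenShokrollahi1997, (15.12)] -/
theorem schoenhage_sides₁ (hF : IsUniversalSpectralPoint ℂ F) {n : ℕ} (hn : 2 ≤ n) :
    (n : ℝ) ^ Real.logb 2 (F (matMulTensor ℂ 1 2 1)) * (n : ℝ) ^ Real.logb 2 (F (matMulTensor ℂ 1 1 2)) +
      (((n - 1) * (n - 1) : ℕ) : ℝ) ^ Real.logb 2 (F (matMulTensor ℂ 2 1 1)) ≤ (n * n + 1 : ℕ) := by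
  have hn1 : 1 ≤ n := le_trans one_le_two hn
  have hM : 1 ≤ (n - 1) * (n - 1) := Nat.one_le_iff_ne_zero.2 (Nat.mul_ne_zero (by omega) (by omega))
  obtain ⟨-, h₂, h₃⟩ := rpow_le_map_line hF hn1
  obtain ⟨h₁, -, -⟩ := rpow_le_map_line hF hM
  have hS := schoenhage₁ hF hn hn
  rw [(map_two_sides hF le_rfl hn1 hn1).2.1] at hS
  have hprod : (n : ℝ) ^ Real.logb 2 (F (matMulTensor ℂ 1 2 1)) * (n : ℝ) ^ Real.logb 2 (F (matMulTensor ℂ 1 1 2))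
      ≤ F (matMulTensor ℂ 1 n 1) * F (matMulTensor ℂ 1 1 n) :=
    mul_le_mul h₂ h₃ (Real.rpow_nonneg (Nat.cast_nonneg n) _)
      (le_trans (Real.rpow_nonneg (Nat.cast_nonneg n) _) h₂)
  linarith

/-- **Schönhage's constraint, last slot**: `n^{θ₁}·n^{θ₂} + ((n−1)²)^{θ₃} ≤ n² + 1` (`n ≥ 2`).
[cite: BurgisserClausenShokrollahi1997, (15.12)] -/
theorem schoenhage_sides₃ (hF : IsUniversalSpectralPoint ℂ F) {n : ℕ} (hn : 2 ≤ n) :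
    (n : ℝ) ^ Real.logb 2 (F (matMulTensor ℂ 2 1 1)) * (n : ℝ) ^ Real.logb 2 (F (matMulTensor ℂ 1 2 1)) +
      (((n - 1) * (n - 1) : ℕ) : ℝ) ^ Real.logb 2 (F (matMulTensor ℂ 1 1 2)) ≤ (n * n + 1 : ℕ) := by
  have hn1 : 1 ≤ n := le_trans one_le_two hn
  have hM : 1 ≤ (n - 1) * (n - 1) := Nat.one_le_iff_ne_zero.2 (Nat.mul_ne_zero (by omega) (by omega))
  obtain ⟨h₁, h₂, -⟩ := rpow_le_map_line hF hn1
  obtain ⟨-, -, h₃⟩ := rpow_le_map_line hF hM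
  have hS := schoenhage₃ hF hn hn
  rw [(map_two_sides hF hn1 hn1 le_rfl).2.2] at hS
  have hprod : (n : ℝ) ^ Real.logb 2 (F (matMulTensor ℂ 2 1 1)) * (n : ℝ) ^ Real.logb 2 (F (matMulTensor ℂ 1 2 1))
      ≤ F (matMulTensor ℂ n 1 1) * F (matMulTensor ℂ 1 n 1) :=
    mul_le_mul h₁ h₂ (Real.rpow_nonneg (Nat.cast_nonneg n) _)
      (le_trans (Real.rpow_nonneg (Nat.cast_nonneg n) _) h₁)
  linarith

/-- The three constraints at once, in exponent form: with `θ = (log₂F⟨2,1,1⟩, log₂F⟨1,2,1⟩, log₂F⟨1,1,2⟩)`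
and `n ≥ 2`, `n^{θᵢ+θⱼ} + (n−1)^{2θₖ} ≤ n²+1` for every arrangement `{i,j,k} = {1,2,3}`.
[cite: AlmanLiPratt2026, Proposition 8.1 (proof)] -/
theorem schoenhage_body (hF : IsUniversalSpectralPoint ℂ F) {n : ℕ} (hn : 2 ≤ n) :
    (n : ℝ) ^ (Real.logb 2 (F (matMulTensor ℂ 2 1 1)) + Real.logb 2 (F (matMulTensor ℂ 1 1 2))) +
        ((n : ℝ) - 1) ^ (2 * Real.logb 2 (F (matMulTensor ℂ 1 2 1))) ≤ (n : ℝ) ^ 2 + 1 ∧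
    (n : ℝ) ^ (Real.logb 2 (F (matMulTensor ℂ 1 2 1)) + Real.logb 2 (F (matMulTensor ℂ 1 1 2))) +
        ((n : ℝ) - 1) ^ (2 * Real.logb 2 (F (matMulTensor ℂ 2 1 1))) ≤ (n : ℝ) ^ 2 + 1 ∧
    (n : ℝ) ^ (Real.logb 2 (F (matMulTensor ℂ 2 1 1)) + Real.logb 2 (F (matMulTensor ℂ 1 2 1))) +
        ((n : ℝ) - 1) ^ (2 * Real.logb 2 (F (matMulTensor ℂ 1 1 2))) ≤ (n : ℝ) ^ 2 + 1 := by
  have hn0 : (0 : ℝ) < n := by exact_mod_cast (lt_of_lt_of_le two_pos hn)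
  have hn1 : 1 ≤ n := le_trans one_le_two hn
  have hcastM : (((n - 1) * (n - 1) : ℕ) : ℝ) = ((n : ℝ) - 1) ^ (2 : ℕ) := by
    rw [Nat.cast_mul, Nat.cast_sub hn1]; push_cast; ring
  have hcastR : (((n * n + 1 : ℕ)) : ℝ) = (n : ℝ) ^ 2 + 1 := by push_cast; ring
  have hm1 : (0 : ℝ) ≤ (n : ℝ) - 1 := by
    have : (1 : ℝ) ≤ n := by exact_mod_cast hn1
    linarith
  have key : ∀ θ : ℝ, (((n - 1) * (n - 1) : ℕ) : ℝ) ^ θ = ((n : ℝ) - 1) ^ (2 * θ) := by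
    intro θ
    rw [hcastM, ← Real.rpow_natCast _ 2, ← Real.rpow_mul hm1]
    norm_num
  have e₂ := schoenhage_sides₂ hF hn
  have e₁ := schoenhage_sides₁ hF hn
  have e₃ := schoenhage_sides₃ hF hn
  rw [← Real.rpow_add hn0, key, hcastR] at e₁ e₂ e₃
  exact ⟨e₂, e₁, e₃⟩

end Summit.MatrixMultiplication.MatrixMultiplication.Theorems.OutsiderSandwichEdgeEnvelope
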